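import Literature.Analysis.FluidPDE.StokesTorus
import Literature.Analysis.FunctionSpaces.TorusTrigPoly
import HarnessLib

/-!
# Dimension of the Galerkin spaces of the Stokes operator on `T^d` — proofs

This file discharges the named fact `Torus.finrank_galerkinSpace` of
`Literature/Analysis/FluidPDE/StokesTorus` (kept in its own sibling file, next to
`StokesTorusProofs`, so that the statement file's import closure is unchanged; it additionally
needs the orthogonality relation `Torus.integral_mFourier` of `TorusTrigPoly`):

  `dim galerkinSpace N = #(galerkinIndex N) · (d − 1)`,

the eigenvalue count of the Stokes operator in the space-periodic case (Constantin–Foias 1988,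
Ch. 4, (4.28)–(4.42) and the proof of Prop. 4.14: for each `k ∈ ℤⁿ ∖ {0}` there are `2(n − 1)`
eigenfunctions `c w_k + c̄ w_{-k}`, `c ⊥ k`, the frequencies `k` and `-k` having *the same*
eigenfunctions, whence `N_λ = #{m | λ_m ≤ λ} = (n − 1) · #{k ≠ 0 : |k| ≤ (λ/λ₁)^{1/2}}`).

## The proof

The family `galerkinFamily N` (`cos(2πk·x) a`, `sin(2πk·x) a`, `k ∈ galerkinIndex N`,
`a = projPerp k i`) is redundant: the modes of `k` and `-k` agree up to sign. Instead of choosing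
representatives of the pairs `{k, -k}` we re-index by *twisted modes*

  `g_k(a) := cos(2πk·x) a + sin(2πk·x) a = stokesModeL2 k a true + stokesModeL2 k a false`.

The elementary identity `(Re z + Im z)(Re w + Im w) = Re (z w̄) + Im (z w)` for the characters
`z = e_k(x)`, `w = e_{k'}(x)` and `∫ e_m = δ_{m0}` give the **key orthogonality relation**

  `⟪g_k(a), g_{k'}(b)⟫_{L²} = δ_{k k'} ⟪a, b⟫`      for *all* `k, k' ∈ ℤ^d`

(`Torus.inner_twistMode`; note that `g_k ⟂ g_{-k}` although they span the same frequencies).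
Hence, with `U_k := span {g_k(projPerp k i) : i}`:
* `galerkinSpace N = ⨆_{k ∈ galerkinIndex N} U_k` (`cos_k a = ½ (g_k a + g_{-k} a)`,
  `sin_k a = ½ (g_k a − g_{-k} a)`, `projPerp (-k) = projPerp k`, and `galerkinIndex N` is
  symmetric);
* the `U_k` are pairwise orthogonal;
* `dim U_k = d − 1` for `k ≠ 0`: `a ↦ g_k(a)` is an `L²`-isometry of `ℝ^d`, and
  `span {projPerp k i : i} = k^⊥` has codimension one (`eᵢ = projPerp k i + (kᵢ/|k|²) k`).
Summing the dimensions of a finite orthogonal family of subspaces gives the claim. No choice of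
representatives modulo `±` is needed, and the degenerate cases (`d` empty, `#d = 1`, `N = 0`)
are covered uniformly.

The file introduces no definitions: the twisted spaces enter the auxiliary statements as an
arbitrary family `F` together with the hypothesis `hF : ∀ k, F k = span {g_k(projPerp k i)}`.

## References

* P. Constantin, C. Foias, *Navier–Stokes Equations*, Univ. Chicago Press 1988, Ch. 4,
  (4.28)–(4.42), Remark 4.13, Prop. 4.14 (proof: `N_λ = (n−1)·#{k ≠ 0 : |k| ≤ (λ/λ₁)^{1/2}}`).
* R. Temam, *Navier–Stokes Equations. Theory and Numerical Analysis*, North-Holland 1977,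
  Ch. I §2.6.
-/

noncomputable section

open MeasureTheory TopologicalSpace Filter UnitAddTorus Module
open scoped InnerProductSpace RealInnerProductSpace ENNReal ComplexConjugate

namespace Literature.Analysis.FluidPDE

namespace Torus

variable {d : Type*} [Fintype d] [DecidableEq d]

/-! ### Linear algebra: dimension of a finite orthogonal sum -/

/-- The dimension of the span of finitely many *pairwise orthogonal* finite-dimensional
subspaces of a real inner product space is the sum of their dimensions:
`dim (⨆_{i ∈ s} U_i) = ∑_{i ∈ s} dim U_i` (induction on `s` with
`dim (A + B) + dim (A ∩ B) = dim A + dim B`, orthogonal subspaces meeting trivially). The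
ambient space need not be finite-dimensional. [folklore] -/
theorem finrank_finset_sup_eq_sum_of_isOrtho {E : Type*} [NormedAddCommGroup E]
    [InnerProductSpace ℝ E] {ι : Type*} (s : Finset ι) (U : ι → Submodule ℝ E)
    [∀ i, FiniteDimensional ℝ (U i)] (hU : ∀ i ∈ s, ∀ j ∈ s, i ≠ j → U i ⟂ U j) :
    finrank ℝ ↥(s.sup U) = ∑ i ∈ s, finrank ℝ (U i) := by
  classical
  induction s using Finset.induction_on with
  | empty => simp
  | insert a s ha ih =>
    rw [Finset.sup_insert, Finset.sum_insert ha, ← ih fun i hi j hj hij =>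
      hU i (Finset.mem_insert_of_mem hi) j (Finset.mem_insert_of_mem hj) hij]
    have horth : U a ⟂ s.sup U := by
      rw [Submodule.isOrtho_comm, Submodule.isOrtho_iff_le]
      exact Finset.sup_le fun i hi => Submodule.isOrtho_iff_le.mp
        (hU i (Finset.mem_insert_of_mem hi) a (Finset.mem_insert_self a s)
          (ne_of_mem_of_not_mem hi ha))
    have h := Submodule.finrank_sup_add_finrank_inf_eq (U a) (s.sup U)
    rwa [horth.disjoint.eq_bot, finrank_bot, add_zero] at h

/-! ### Algebra of the Stokes modes -/

omit [DecidableEq d] in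
/-- The Stokes modes are additive in the amplitude. [folklore] -/
theorem stokesMode_add (k : d → ℤ) (a b : EuclideanSpace ℝ d) (c : Bool) :
    stokesMode k (a + b) c = stokesMode k a c + stokesMode k b c := by
  ext1 x
  simp only [stokesMode_apply, ContinuousMap.add_apply, smul_add]

omit [DecidableEq d] in
/-- The Stokes modes are homogeneous in the amplitude. [folklore] -/
theorem stokesMode_smul (k : d → ℤ) (r : ℝ) (a : EuclideanSpace ℝ d) (c : Bool) :
    stokesMode k (r • a) c = r • stokesMode k a c := by
  ext1 x
  simp only [stokesMode_apply, ContinuousMap.smul_apply]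
  exact smul_comm _ r a

omit [DecidableEq d] in
/-- The `L²` Stokes modes are additive in the amplitude. [folklore] -/
theorem stokesModeL2_add (k : d → ℤ) (a b : EuclideanSpace ℝ d) (c : Bool) :
    stokesModeL2 k (a + b) c = stokesModeL2 k a c + stokesModeL2 k b c := by
  simp only [stokesModeL2, stokesMode_add, map_add]

omit [DecidableEq d] in
/-- The `L²` Stokes modes are homogeneous in the amplitude. [folklore] -/
theorem stokesModeL2_smul (k : d → ℤ) (r : ℝ) (a : EuclideanSpace ℝ d) (c : Bool) :
    stokesModeL2 k (r • a) c = r • stokesModeL2 k a c := by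
  simp only [stokesModeL2, stokesMode_smul, map_smul]

omit [DecidableEq d] in
/-- `cos(2π(-k)·x) a = cos(2πk·x) a`. [folklore] -/
theorem stokesMode_neg_true (k : d → ℤ) (a : EuclideanSpace ℝ d) :
    stokesMode (-k) a true = stokesMode k a true := by
  ext1 x
  simp [stokesMode_apply, mFourier_neg]

omit [DecidableEq d] in
/-- `sin(2π(-k)·x) a = -sin(2πk·x) a`. [folklore] -/
theorem stokesMode_neg_false (k : d → ℤ) (a : EuclideanSpace ℝ d) :
    stokesMode (-k) a false = -stokesMode k a false := by
  ext1 x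
  simp [stokesMode_apply, mFourier_neg]

omit [DecidableEq d] in
/-- `cos(2π(-k)·x) a = cos(2πk·x) a` in `L²`. [folklore] -/
theorem stokesModeL2_neg_true (k : d → ℤ) (a : EuclideanSpace ℝ d) :
    stokesModeL2 (-k) a true = stokesModeL2 k a true := by
  simp only [stokesModeL2, stokesMode_neg_true]

omit [DecidableEq d] in
/-- `sin(2π(-k)·x) a = -sin(2πk·x) a` in `L²`. [folklore] -/
theorem stokesModeL2_neg_false (k : d → ℤ) (a : EuclideanSpace ℝ d) :
    stokesModeL2 (-k) a false = -stokesModeL2 k a false := by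
  simp only [stokesModeL2, stokesMode_neg_false, map_neg]

/-- The amplitude vectors are even in the frequency: `projPerp (-k) i = projPerp k i`
(`eᵢ − ((-kᵢ)/|k|²)(-k) = eᵢ − (kᵢ/|k|²) k`). [folklore] -/
theorem projPerp_neg (k : d → ℤ) (i : d) : projPerp (-k) i = projPerp k i := by
  have h1 : FunctionSpaces.Torus.latticeVec (-k) = -FunctionSpaces.Torus.latticeVec k := by
    ext j
    simp
  simp only [projPerp, h1, FunctionSpaces.Torus.freqNormSq_neg, Pi.neg_apply, Int.cast_neg,
    neg_div, smul_neg, neg_smul, neg_neg]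

/-! ### Twisted modes `cos(2πk·x) a + sin(2πk·x) a` and their orthogonality -/

omit [DecidableEq d] in
/-- The twisted mode `stokesModeL2 k a true + stokesModeL2 k a false` is represented by
`x ↦ (Re e_k(x) + Im e_k(x)) a = (cos(2πk·x) + sin(2πk·x)) a`. [folklore] -/
theorem coeFn_twistMode (k : d → ℤ) (a : EuclideanSpace ℝ d) :
    ((stokesModeL2 k a true + stokesModeL2 k a false :
        Lp (EuclideanSpace ℝ d) 2 (volume : Measure (UnitAddTorus d))) :
        UnitAddTorus d → EuclideanSpace ℝ d) =ᵐ[volume]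
      fun x => ((mFourier k x).re + (mFourier k x).im) • a := by
  filter_upwards [Lp.coeFn_add (stokesModeL2 k a true) (stokesModeL2 k a false),
    coeFn_stokesModeL2 k a true, coeFn_stokesModeL2 k a false] with x hx h1 h2
  rw [hx, Pi.add_apply, h1, h2, stokesMode_apply, stokesMode_apply, add_smul]
  simp

omit [DecidableEq d] in
/-- **Orthogonality of the twisted modes.** For all frequencies `k, k' ∈ ℤ^d` and amplitudes
`a, b ∈ ℝ^d`,
`⟪(cos + sin)(2πk·x) a, (cos + sin)(2πk'·x) b⟫_{L²(T^d)} = δ_{k k'} ⟪a, b⟫`: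
pointwise `(Re z + Im z)(Re w + Im w) = Re (z w̄) + Im (z w)` with `z w̄ = e_{k-k'}`,
`z w = e_{k+k'}`, and `∫ e_m = δ_{m0}` (so `∫ Re e_m = δ_{m0}`, `∫ Im e_m = 0`). In particular
the twisted modes of `k` and `-k ≠ k` are orthogonal, and `a ↦ (cos + sin)(2πk·x) a` is an
isometry `ℝ^d → L²`. This refines the count "`2(n−1)` eigenfunctions for each pair `±k`" of
Constantin–Foias. [cite: ConstantinFoias1988, Ch. 4 eq. 4.42 and proof of Prop. 4.14] -/
theorem inner_twistMode (k k' : d → ℤ) (a b : EuclideanSpace ℝ d) :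
    ⟪(stokesModeL2 k a true + stokesModeL2 k a false :
        Lp (EuclideanSpace ℝ d) 2 (volume : Measure (UnitAddTorus d))),
      stokesModeL2 k' b true + stokesModeL2 k' b false⟫_ℝ =
      if k = k' then ⟪a, b⟫_ℝ else 0 := by
  classical
  have hpt : ∀ x : UnitAddTorus d,
      ((mFourier k x).re + (mFourier k x).im) * ((mFourier k' x).re + (mFourier k' x).im) =
        (mFourier (k - k') x).re + (mFourier (k + k') x).im := by
    intro x
    rw [sub_eq_add_neg, mFourier_add, mFourier_add, mFourier_neg, Complex.mul_re, Complex.mul_im,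
      Complex.conj_re, Complex.conj_im]
    ring
  have hre : ∀ m : d → ℤ, ∫ x : UnitAddTorus d, (mFourier m x).re = if m = 0 then 1 else 0 := by
    intro m
    have h := Complex.reCLM.integral_comp_comm
      ((mFourier m).continuous.integrable_unitAddTorus (d := d))
    simp only [Complex.reCLM_apply] at h
    rw [h, FunctionSpaces.Torus.integral_mFourier]
    split_ifs <;> simp
  have him : ∀ m : d → ℤ, ∫ x : UnitAddTorus d, (mFourier m x).im = 0 := by
    intro m
    have h := Complex.imCLM.integral_comp_comm
      ((mFourier m).continuous.integrable_unitAddTorus (d := d))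
    simp only [Complex.imCLM_apply] at h
    rw [h, FunctionSpaces.Torus.integral_mFourier]
    split_ifs <;> simp
  have hi1 : Integrable (fun x : UnitAddTorus d => (mFourier (k - k') x).re) volume :=
    (Complex.continuous_re.comp (mFourier (k - k')).continuous).integrable_unitAddTorus
  have hi2 : Integrable (fun x : UnitAddTorus d => (mFourier (k + k') x).im) volume :=
    (Complex.continuous_im.comp (mFourier (k + k')).continuous).integrable_unitAddTorus
  rw [L2.inner_def]
  trans ∫ x : UnitAddTorus d, ((mFourier (k - k') x).re + (mFourier (k + k') x).im) * ⟪a, b⟫_ℝ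
  · refine integral_congr_ae ?_
    filter_upwards [coeFn_twistMode k a, coeFn_twistMode k' b] with x h1 h2
    rw [h1, h2, real_inner_smul_left, real_inner_smul_right, ← mul_assoc, hpt]
  · rw [integral_mul_const, integral_add hi1 hi2, hre, him, add_zero]
    by_cases hk : k = k'
    · subst hk
      simp
    · rw [if_neg hk, if_neg (sub_ne_zero.mpr hk), zero_mul]

/-! ### The Galerkin space as an orthogonal sum of twisted spaces -/

/-- Every twisted mode `(cos + sin)(2πk·x) projPerp k i` with `k ∈ galerkinIndex N` lies in the
sum `⨆_{k ∈ galerkinIndex N} F k` of the twisted spaces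
`F k = span {(cos + sin)(2πk·x) projPerp k i : i}`. [folklore] -/
theorem twistMode_mem_finset_sup
    (F : (d → ℤ) → Submodule ℝ (Lp (EuclideanSpace ℝ d) 2 (volume : Measure (UnitAddTorus d))))
    (hF : ∀ k, F k = Submodule.span ℝ (Set.range fun i : d =>
      stokesModeL2 k (projPerp k i) true + stokesModeL2 k (projPerp k i) false))
    {N : ℕ} {k : d → ℤ} (hk : k ∈ galerkinIndex (d := d) N) (i : d) :
    stokesModeL2 k (projPerp k i) true + stokesModeL2 k (projPerp k i) false ∈
      (galerkinIndex (d := d) N).sup F := by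
  have h : stokesModeL2 k (projPerp k i) true + stokesModeL2 k (projPerp k i) false ∈ F k := by
    rw [hF k]
    exact Submodule.subset_span ⟨i, rfl⟩
  exact Finset.le_sup (f := F) hk h

/-- **The Galerkin space is the sum of the twisted spaces**:
`galerkinSpace N = ⨆_{k ∈ galerkinIndex N} span {(cos + sin)(2πk·x) projPerp k i : i}`.
Indeed `2 cos(2πk·x) a = g_k(a) + g_{-k}(a)` and `2 sin(2πk·x) a = g_k(a) − g_{-k}(a)` for the
twisted modes `g_{±k}`, `projPerp (-k) = projPerp k`, and `galerkinIndex N` is symmetric under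
`k ↦ -k`; conversely each `g_k(projPerp k i)` is the sum of two members of the Galerkin family
("`k` and `-k` have exactly the same eigenfunctions", Constantin–Foias).
[cite: ConstantinFoias1988, Ch. 4 eq. 4.42 and proof of Prop. 4.14] -/
theorem galerkinSpace_eq_finset_sup
    (F : (d → ℤ) → Submodule ℝ (Lp (EuclideanSpace ℝ d) 2 (volume : Measure (UnitAddTorus d))))
    (hF : ∀ k, F k = Submodule.span ℝ (Set.range fun i : d =>
      stokesModeL2 k (projPerp k i) true + stokesModeL2 k (projPerp k i) false))
    (N : ℕ) : galerkinSpace (d := d) N = (galerkinIndex (d := d) N).sup F := by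
  apply le_antisymm
  · refine Submodule.span_le.mpr ?_
    rintro _ ⟨⟨⟨k, hk⟩, i, c⟩, rfl⟩
    rw [SetLike.mem_coe]
    have h1 := twistMode_mem_finset_sup F hF hk i
    have h2 := twistMode_mem_finset_sup F hF (neg_mem_galerkinIndex hk) i
    rw [projPerp_neg, stokesModeL2_neg_true, stokesModeL2_neg_false] at h2
    have hC := add_mem h1 h2
    have hS := sub_mem h1 h2
    cases c with
    | false =>
      show stokesModeL2 k (projPerp k i) false ∈ (galerkinIndex (d := d) N).sup F
      refine (Submodule.smul_mem_iff _ (two_ne_zero' ℝ)).mp ?_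
      convert hS using 1
      rw [two_smul]
      abel
    | true =>
      show stokesModeL2 k (projPerp k i) true ∈ (galerkinIndex (d := d) N).sup F
      refine (Submodule.smul_mem_iff _ (two_ne_zero' ℝ)).mp ?_
      convert hC using 1
      rw [two_smul]
      abel
  · refine Finset.sup_le fun k hk => ?_
    rw [hF k]
    refine Submodule.span_le.mpr ?_
    rintro _ ⟨i, rfl⟩
    exact add_mem (Submodule.subset_span ⟨(⟨k, hk⟩, i, true), rfl⟩)
      (Submodule.subset_span ⟨(⟨k, hk⟩, i, false), rfl⟩)

/-- Distinct twisted spaces are orthogonal: for `k ≠ k'`,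
`span {(cos + sin)(2πk·x) projPerp k i} ⟂ span {(cos + sin)(2πk'·x) projPerp k' j}`
(`Torus.inner_twistMode`). [folklore] -/
theorem isOrtho_twistSpace
    (F : (d → ℤ) → Submodule ℝ (Lp (EuclideanSpace ℝ d) 2 (volume : Measure (UnitAddTorus d))))
    (hF : ∀ k, F k = Submodule.span ℝ (Set.range fun i : d =>
      stokesModeL2 k (projPerp k i) true + stokesModeL2 k (projPerp k i) false))
    {k k' : d → ℤ} (h : k ≠ k') : F k ⟂ F k' := by
  rw [hF k, hF k', Submodule.isOrtho_span]
  rintro _ ⟨i, rfl⟩ _ ⟨j, rfl⟩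
  simp only [inner_twistMode, if_neg h]

/-! ### The dimension of a twisted space -/

/-- For `k ≠ 0` the amplitudes `projPerp k i = eᵢ − (kᵢ/|k|²) k`, `i ∈ d`, span a subspace of
`ℝ^d` of dimension `#d − 1` (namely `k^⊥`): they are orthogonal to `k`, and together with `k`
they span `ℝ^d` since `eᵢ = projPerp k i + (kᵢ/|k|²) k`. [folklore] -/
theorem finrank_span_range_projPerp {k : d → ℤ} (hk : k ≠ 0) :
    finrank ℝ ↥(Submodule.span ℝ (Set.range (projPerp k))) = Fintype.card d - 1 := by
  have hK : FunctionSpaces.Torus.latticeVec k ≠ 0 := by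
    intro h
    apply hk
    funext j
    have hj := congrArg (fun v : EuclideanSpace ℝ d => v j) h
    simpa using hj
  have h1 : Submodule.span ℝ (Set.range (projPerp k)) ≤
      (ℝ ∙ FunctionSpaces.Torus.latticeVec k)ᗮ := by
    refine Submodule.span_le.mpr ?_
    rintro _ ⟨i, rfl⟩
    exact Submodule.mem_orthogonal_singleton_iff_inner_right.mpr (inner_latticeVec_projPerp hk i)
  have h2 : Submodule.span ℝ (Set.range (projPerp k)) ⊔ (ℝ ∙ FunctionSpaces.Torus.latticeVec k) =
      ⊤ := by
    refine eq_top_iff.mpr ?_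
    rw [← (EuclideanSpace.basisFun d ℝ).toBasis.span_eq, OrthonormalBasis.coe_toBasis]
    refine Submodule.span_le.mpr ?_
    rintro _ ⟨i, rfl⟩
    have hi : (EuclideanSpace.basisFun d ℝ) i = projPerp k i +
        ((k i : ℝ) / FunctionSpaces.Torus.freqNormSq k) • FunctionSpaces.Torus.latticeVec k := by
      rw [EuclideanSpace.basisFun_apply, projPerp, sub_add_cancel]
    rw [SetLike.mem_coe, hi]
    exact Submodule.add_mem_sup (Submodule.subset_span ⟨i, rfl⟩)
      (Submodule.smul_mem _ _ (Submodule.mem_span_singleton_self _))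
  have hE : finrank ℝ (EuclideanSpace ℝ d) = Fintype.card d := finrank_euclideanSpace
  have h3 : finrank ℝ ↥(ℝ ∙ FunctionSpaces.Torus.latticeVec k) = 1 := finrank_span_singleton hK
  have h4 : Fintype.card d ≤ finrank ℝ ↥(Submodule.span ℝ (Set.range (projPerp k))) +
      finrank ℝ ↥(ℝ ∙ FunctionSpaces.Torus.latticeVec k) := by
    have h := Submodule.finrank_add_le_finrank_add_finrank
      (Submodule.span ℝ (Set.range (projPerp k))) (ℝ ∙ FunctionSpaces.Torus.latticeVec k)
    rwa [h2, finrank_top, hE] at h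
  have h5 : finrank ℝ ↥(Submodule.span ℝ (Set.range (projPerp k))) ≤
      finrank ℝ ↥(ℝ ∙ FunctionSpaces.Torus.latticeVec k)ᗮ := Submodule.finrank_mono h1
  have h6 : finrank ℝ ↥(ℝ ∙ FunctionSpaces.Torus.latticeVec k) +
      finrank ℝ ↥(ℝ ∙ FunctionSpaces.Torus.latticeVec k)ᗮ = Fintype.card d := by
    rw [Submodule.finrank_add_finrank_orthogonal, hE]
  omega

/-- **Each twisted space has dimension `#d − 1`**: for `k ≠ 0`,
`dim span {(cos + sin)(2πk·x) projPerp k i : i} = #d − 1`, since `a ↦ (cos + sin)(2πk·x) a` is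
an injective (indeed isometric, `Torus.inner_twistMode`) linear map `ℝ^d → L²` and the
`projPerp k i` span the `(#d − 1)`-dimensional space `k^⊥` (half of Constantin–Foias'
"`2(n − 1)` eigenfunctions for each `k ≠ 0`").
[cite: ConstantinFoias1988, Ch. 4 eq. 4.42 and proof of Prop. 4.14] -/
theorem finrank_twistSpace
    (F : (d → ℤ) → Submodule ℝ (Lp (EuclideanSpace ℝ d) 2 (volume : Measure (UnitAddTorus d))))
    (hF : ∀ k, F k = Submodule.span ℝ (Set.range fun i : d =>
      stokesModeL2 k (projPerp k i) true + stokesModeL2 k (projPerp k i) false))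
    {k : d → ℤ} (hk : k ≠ 0) : finrank ℝ ↥(F k) = Fintype.card d - 1 := by
  let T : EuclideanSpace ℝ d →ₗ[ℝ] Lp (EuclideanSpace ℝ d) 2 (volume : Measure (UnitAddTorus d)) :=
    { toFun := fun a => stokesModeL2 k a true + stokesModeL2 k a false
      map_add' := fun a b => by
        simp only [stokesModeL2_add]
        abel
      map_smul' := fun r a => by
        simp only [stokesModeL2_smul, smul_add, RingHom.id_apply] }
  have hTa : ∀ a, T a = stokesModeL2 k a true + stokesModeL2 k a false := fun a => rfl
  have hT : Function.Injective T := by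
    rw [← LinearMap.ker_eq_bot, LinearMap.ker_eq_bot']
    intro a ha
    have h := inner_twistMode k k a a
    rw [if_pos rfl, ← hTa, ha, inner_zero_left] at h
    exact inner_self_eq_zero.mp h.symm
  have hmap : F k = (Submodule.span ℝ (Set.range (projPerp k))).map T := by
    rw [hF k, Submodule.map_span, ← Set.range_comp]
    rfl
  rw [hmap, ← (Submodule.equivMapOfInjective T hT _).finrank_eq]
  exact finrank_span_range_projPerp hk

/-! ### The dimension count -/

/-- **Dimension of the Galerkin spaces** (discharge of `Torus.finrank_galerkinSpace`):
`dim galerkinSpace N = #(galerkinIndex N) · (#d − 1)` — the Galerkin space is the orthogonal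
sum over `k ∈ galerkinIndex N` of the twisted spaces `span {(cos + sin)(2πk·x) projPerp k i}`,
each of dimension `#d − 1`. This is Constantin–Foias' eigenvalue count for the Stokes operator
on the torus, `N_λ = (n − 1) · #{k ∈ ℤⁿ ∖ {0} : |k| ≤ (λ/λ₁)^{1/2}}`, at `λ = 4π²N²`.
[cite: ConstantinFoias1988, Ch. 4 eq. 4.42 and proof of Prop. 4.14] -/
theorem finrank_galerkinSpace_holds : finrank_galerkinSpace (d := d) := by
  intro N
  obtain ⟨F, hF⟩ : ∃ F : (d → ℤ) →
      Submodule ℝ (Lp (EuclideanSpace ℝ d) 2 (volume : Measure (UnitAddTorus d))),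
      ∀ k, F k = Submodule.span ℝ (Set.range fun i : d =>
        stokesModeL2 k (projPerp k i) true + stokesModeL2 k (projPerp k i) false) :=
    ⟨_, fun k => rfl⟩
  haveI : ∀ k, FiniteDimensional ℝ (F k) := fun k => by
    rw [hF k]
    exact FiniteDimensional.span_of_finite ℝ (Set.finite_range _)
  rw [galerkinSpace_eq_finset_sup F hF N, finrank_finset_sup_eq_sum_of_isOrtho
    (galerkinIndex (d := d) N) F fun k _ k' _ hkk' => isOrtho_twistSpace F hF hkk']
  exact Finset.sum_const_nat fun k hk => finrank_twistSpace F hF (mem_galerkinIndex_iff'.mp hk).2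

end Torus

end Literature.Analysis.FluidPDE
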